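import Summits.ValiantsHypothesis.ValiantsHypothesis.Theorems.LMRWhatWouldSuffice
import Literature.Computability.AlgebraicComplexity.Yab15BRank
import Literature.Computability.AlgebraicComplexity.HI16BinaryDC
import HarnessLib

/-!
# What would suffice — the LMR corpus, part 2: links over the TYPED sections (Yabe 2015, Hüttenhain–Ikenmeyer
# 2016, Landsberg–Ressayre 2017 full symmetry) against rungs V0 / V6

val-lit bookkeeping file (unit `val-lit-lead-lmr`, D-0074), companion of
`LMRWhatWouldSuffice.lean` (p416561). HONEST FRAMING: nothing in this file is progress on `VP ≠ VNP`;
it records, as kernel-checked implications ending in EXISTING rung declarations, what the newly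
typed literature sections (val-lit typers t12 / t15 / t17: `LR17EquivariantRepresentations.lean`,
`HI16BinaryDC.lean`, `Yab15BRank.lean`) would have to be completed by. Every open link is a
HYPOTHESIS `(h : …)`; every unproved published result enters as a NAMED FACT hypothesis
(`yabe2015_cor_1_6`); no conjecture is asserted and no new `Prop` is introduced.

Rungs (existing decls): `Theses.DetQP.DetqpSuperquadratic` (stmt-ValiantsHypothesis-0318, crux rank 2
of route DetQP: `dc(per_n) ≥ n^{2+ε}` eventually — itself SHORT of `DetqpThesis`),
`Theses.DetQP.DetqpThesis` (stmt-0315, V0: `dc(per_n)` not quasi-polynomially bounded),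
`_root_.ValiantsHypothesis` (V6, through the CLOSED `Theses.DetQP.DcqpToVH`).

## The chains

* **Superquadratic template** (`detqpSuperquadratic_of_eventual_rpow_lower_bound`,
  `detqpSuperquadratic_of_eventual_pow_lower_bound`): any eventual lower bound
  `c · n^r ≤ dc(per_n)` with a real `r > 2` (resp. a natural exponent `k ≥ 3`) and `c > 0` gives
  `DetqpSuperquadratic` (with `ε = (r − 2)/2`, absorbing the constant). This is the form in which a
  POLYNOMIAL-rate engine past the `n²` wall would close crux 0318 — and no more: a polynomial lower
  bound is quasi-polynomially bounded, so it never reaches `DetqpThesis`.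
* **Yabe's programme** (`detqpSuperquadratic_of_yabeProgramme`): Yabe 2015, Cor. 1.6 (NAMED FACT
  `yabe2015_cor_1_6`, typed by val-lit-t17 over `bRank` = Def. 1.4): for a fixed `k ≥ 2`, a sequence
  of zeros `X_d ∈ Zeros(per_d)` with `brank((per_d)_{X_d}^{(2k)}) ≥ c · d^{2k}` eventually gives
  `dc(per_d) ≥ c' d^{2k}` eventually, hence `DetqpSuperquadratic`. This is the only route past `n²`
  named in print inside the pointwise-differential-invariant family (Mignon–Ressayre / Cai–Chen–Li /
  Alper–Bogart–Velasco / Yabe; GAP-LEDGER row LMR-1); the hypothesis is OPEN for every `k ≥ 2`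
  (for `k = 1` it is Mignon–Ressayre's Hessian, capped at `d²`).
* **Full-symmetry quasi-polynomial symmetrisation** (`detqpThesis_of_fullQPSymmetrization`,
  `valiantsHypothesis_of_fullQPSymmetrization`): the companion file's left-symmetry hypothesis with
  LR's full realised symmetry group `permSymmetrySubst ℂ m = 𝔾_{perm_m}` (left/right torus and
  permutations, transposition) in place of `leftMonomialSubst ℂ m`; it follows from the left form by
  antitonicity of equivariance in the group (`HasEquivariantDetRepr.anti`,
  `leftMonomialSubst_le_permSymmetrySubst`). NOTE ON THE NOTION (GAP-LEDGER row LMR-3 v1, referees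
  val-lit-ref-1/ref-2): the tree's `HasEquivariantDetRepr` asks for EXACT, TRANSPOSITION-FREE lifts
  `A(γ·x) = g·A(x)·h⁻¹` (identity component of `𝔾_{det}`), which is stronger than Landsberg–Ressayre's
  Def. 1.3 (lifts anywhere in `𝔾_{det_n} ∋` transposition); so an affirmative answer to LR17
  Question 2.2 implies these hypotheses only if the lifts can be chosen transposition-free.
* **Binary complexity is the wrong direction** (`determinantalComplexity_complex_le_binaryDetComplexity`,
  `not_isQPBounded_bdc_of_detqpThesis`): `dc_ℂ(per_m) ≤ bdc(per_m)` (Hüttenhain–Ikenmeyer 2016 §1,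
  base change of a binary variable matrix; `bdc` attained by Thm. 2 = Grenet), so `DetqpThesis`
  IMPLIES that `bdc(per_m)` is not quasi-polynomially bounded — a binary / constant-free lower bound
  (HI16 Prop. 12: `per ∉ DET⁰ = VP_s⁰`) is a CONSEQUENCE of V0, not a route to it.

References: A. Yabe, *Bi-polynomial rank and determinantal complexity*, arXiv:1504.00151 (2015),
Def. 1.4, Thm. 1.5, Cor. 1.6; J. Hüttenhain, C. Ikenmeyer, *Binary determinantal complexity*, Linear
Algebra Appl. 504 (2016) 559–573, arXiv:1410.8202, §1, Thm. 2 (printed 1.3), Prop. 12 (printed 5.2);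
J. M. Landsberg, N. Ressayre, *Permanent v. determinant: an exponential lower bound assuming symmetry
and a potential path towards Valiant's conjecture*, Differential Geom. Appl. 55 (2017),
arXiv:1508.05788, Def. 1.3, Thm. 2.1, Thm. 2.8, Question 2.2, Cor. 2.3.
-/

set_option linter.dupNamespace false

namespace Summit.ValiantsHypothesis.ValiantsHypothesis.Theorems.LMRWhatWouldSufficeTyped

open Literature.Computability.AlgebraicComplexity
open Summit.ValiantsHypothesis.Theorems.DetqpThesis.Negative
open Summit.ValiantsHypothesis.ValiantsHypothesis.Theorems.LMRWhatWouldSuffice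
open MvPolynomial

noncomputable section

/-! ### The superquadratic template (crux 0318) -/

/-- **Superquadratic template, real exponent.** An eventual lower bound `c · n^r ≤ dc(per_n)` with
`r > 2`, `c > 0` gives `DetqpSuperquadratic` (take `ε = (r − 2)/2`; for `n ≥ (1/c)^{1/ε}` one has
`c · n^ε ≥ 1`, so `n^{2+ε} ≤ c · n^{2+2ε} = c · n^r`). [folklore] -/
theorem detqpSuperquadratic_of_eventual_rpow_lower_bound {r c : ℝ} (hr : 2 < r) (hc : 0 < c)
    (h : ∃ N : ℕ, ∀ n ≥ N, c * (n : ℝ) ^ r ≤ (determinantalComplexity (perPoly (Fin n) ℂ) : ℝ)) :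
    Theses.DetQP.DetqpSuperquadratic := by
  obtain ⟨N, hN⟩ := h
  set ε : ℝ := (r - 2) / 2 with hε
  have hε0 : 0 < ε := by rw [hε]; linarith
  -- threshold beyond which `c * n ^ ε ≥ 1`
  obtain ⟨N₁, hN₁⟩ : ∃ N₁ : ℕ, ∀ n : ℕ, N₁ ≤ n → 1 ≤ c * (n : ℝ) ^ ε := by
    refine ⟨⌈(1 / c) ^ (1 / ε)⌉₊, fun n hn => ?_⟩
    have h0 : (0 : ℝ) ≤ (1 / c) ^ (1 / ε) := Real.rpow_nonneg (by positivity) _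
    have hle : (1 / c) ^ (1 / ε) ≤ (n : ℝ) := (Nat.le_ceil _).trans (by exact_mod_cast hn)
    have h1 : ((1 / c) ^ (1 / ε)) ^ ε ≤ (n : ℝ) ^ ε := Real.rpow_le_rpow h0 hle hε0.le
    rw [← Real.rpow_mul (by positivity), one_div_mul_cancel hε0.ne', Real.rpow_one] at h1
    calc (1 : ℝ) = c * (1 / c) := by field_simp
      _ ≤ c * (n : ℝ) ^ ε := by gcongr
  refine ⟨ε, hε0, max (max N N₁) 1, fun n hn => ?_⟩
  have hnN : N ≤ n := ((le_max_left _ _).trans (le_max_left _ _)).trans hn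
  have hnN₁ : N₁ ≤ n := ((le_max_right _ _).trans (le_max_left _ _)).trans hn
  have hn1 : 1 ≤ n := (le_max_right _ _).trans hn
  have hnpos : (0 : ℝ) < n := by exact_mod_cast hn1
  calc (n : ℝ) ^ (2 + ε) ≤ (c * (n : ℝ) ^ ε) * (n : ℝ) ^ (2 + ε) :=
        le_mul_of_one_le_left (Real.rpow_nonneg hnpos.le _) (hN₁ n hnN₁)
    _ = c * (n : ℝ) ^ r := by
        rw [mul_assoc, ← Real.rpow_add hnpos]
        congr 1
        rw [hε]
        ring_nf
    _ ≤ _ := hN n hnN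

/-- **Superquadratic template, natural exponent.** An eventual lower bound `c · n^k ≤ dc(per_n)` with
`k ≥ 3`, `c > 0` gives `DetqpSuperquadratic` — and no more: `n ↦ c · n^k` is quasi-polynomially
bounded, so such a bound never reaches `DetqpThesis`. [folklore] -/
theorem detqpSuperquadratic_of_eventual_pow_lower_bound {k : ℕ} (hk : 3 ≤ k) {c : ℝ} (hc : 0 < c)
    (h : ∃ N : ℕ, ∀ n ≥ N, c * (n : ℝ) ^ k ≤ (determinantalComplexity (perPoly (Fin n) ℂ) : ℝ)) :
    Theses.DetQP.DetqpSuperquadratic := by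
  have hk' : (2 : ℝ) < (k : ℝ) := by
    have : (2 : ℕ) < k := by omega
    exact_mod_cast this
  refine detqpSuperquadratic_of_eventual_rpow_lower_bound hk' hc ?_
  simpa only [Real.rpow_natCast] using h

/-! ### Yabe's programme (Yabe 2015, Cor. 1.6) -/

/-- **Yabe's programme would close crux 0318.** Granted Yabe 2015 Cor. 1.6 (NAMED FACT
`yabe2015_cor_1_6`, a bookkeeping consequence of the main Thm. 1.5): if for some fixed `k ≥ 2` there
are zeros `X_d ∈ Zeros(per_d)` (`d ≥ 1`) with `brank((per_d)_{X_d}^{(2k)}) ≥ c · d^{2k}` for all large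
`d` (`c > 0`), then `dc(per_d) ≥ c' · d^{2k}` eventually, hence `DetqpSuperquadratic`. The hypothesis
is OPEN for every `k ≥ 2`; `brank` is capped by the number of degree-`k` monomials
(`bRank_le_card_degMonomials`), so the programme asks for near-maximal bi-polynomial rank.
Yabe 2015, Def. 1.4, Thm. 1.5, Cor. 1.6. [cite: Yabe2015, Corollary 1.6] -/
theorem detqpSuperquadratic_of_yabeProgramme (h16 : yabe2015_cor_1_6.{0}) {k : ℕ} (hk : 2 ≤ k)
    (X : (d : ℕ) → (Fin d × Fin d → ℂ))
    (hX0 : ∀ d, 1 ≤ d → eval (X d) (perPoly (Fin d) ℂ) = 0)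
    (hX : ∃ c : ℝ, 0 < c ∧ ∃ N : ℕ, ∀ d ≥ N,
      c * (d : ℝ) ^ (2 * k) ≤
        bRank k (homogeneousComponent (2 * k) (transl (X d) (perPoly (Fin d) ℂ)))) :
    Theses.DetQP.DetqpSuperquadratic := by
  obtain ⟨c, hc, hev⟩ := h16 ℂ k (by omega) X hX0 hX
  exact detqpSuperquadratic_of_eventual_pow_lower_bound (k := 2 * k) (by omega) hc hev

/-! ### Full-symmetry quasi-polynomial symmetrisation (Landsberg–Ressayre 2017, Thm. 2.1 / Q. 2.2) -/

/-- **Full quasi-polynomial symmetrisation suffices.** If every affine determinantal representation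
of `per_m` (`m ≥ 3`) of size `s` can be traded for one of size `≤ 2^((log₂ s + c)^c)` that is
equivariant (exact, transposition-free lifts) for LR's full realised symmetry group
`permSymmetrySubst ℂ m` (`𝔾_{perm_m}`: left and right torus-and-permutations, and transposition), then
`DetqpThesis`. From the left form `detqpThesis_of_leftQPSymmetrization` by antitonicity
(`leftMonomialSubst ℂ m ≤ permSymmetrySubst ℂ m`); equivalently, directly from the PROVED Thm. 2.1
lower bound `lr_full_equivariant_lower_holds` (`≥ C(2m,m) − 1`). Landsberg–Ressayre 2017, Thm. 2.1,
Question 2.2, Cor. 2.3. [cite: LandsbergRessayre2017, Cor. 2.3] -/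
theorem detqpThesis_of_fullQPSymmetrization
    (h : ∃ c : ℕ, ∀ m s : ℕ, 3 ≤ m → HasDetRepr (perPoly (Fin m) ℂ) s →
      ∃ s' ≤ 2 ^ ((Nat.log 2 s + c) ^ c),
        HasEquivariantDetRepr (permSymmetrySubst ℂ m) (perPoly (Fin m) ℂ) s') :
    Theses.DetQP.DetqpThesis := by
  obtain ⟨c, hc⟩ := h
  refine detqpThesis_of_leftQPSymmetrization ⟨c, fun m s hm hs => ?_⟩
  obtain ⟨s', hs', hS⟩ := hc m s hm hs
  exact ⟨s', hs', hS.anti (leftMonomialSubst_le_permSymmetrySubst ℂ m)⟩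

/-- Summit form of the full quasi-polynomial symmetrisation hypothesis (through the route's `closes`
and the CLOSED `DcqpToVH`). Landsberg–Ressayre 2017, Cor. 2.3. [cite: LandsbergRessayre2017, Cor. 2.3] -/
theorem valiantsHypothesis_of_fullQPSymmetrization
    (h : ∃ c : ℕ, ∀ m s : ℕ, 3 ≤ m → HasDetRepr (perPoly (Fin m) ℂ) s →
      ∃ s' ≤ 2 ^ ((Nat.log 2 s + c) ^ c),
        HasEquivariantDetRepr (permSymmetrySubst ℂ m) (perPoly (Fin m) ℂ) s') :
    _root_.ValiantsHypothesis :=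
  Theses.DetQP.closes (detqpThesis_of_fullQPSymmetrization h)
    Summit.ValiantsHypothesis.Theorems.dcqpToVH_proof_detQP

/-! ### Binary determinantal complexity (Hüttenhain–Ikenmeyer 2016): the direction of the comparison -/

/-- `dc_ℂ(per_m) ≤ bdc(per_m)`: a binary variable matrix over `ℤ` with determinant `per_m`, of the
minimal size `bdc(per_m)` (attained: the defining set is nonempty by Thm. 2 = Grenet,
`huttenhainIkenmeyer2016_thm2`), base-changes to an affine representation of `per_m` over `ℂ`
(`HasBinaryDetRepr.hasDetRepr_map`, `map_perPoly`). Hüttenhain–Ikenmeyer 2016, §1 ("a stronger model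
of computation"). [cite: HuttenhainIkenmeyer2016, §1] -/
theorem determinantalComplexity_complex_le_binaryDetComplexity (m : ℕ) :
    determinantalComplexity (perPoly (Fin m) ℂ) ≤ binaryDetComplexity (perPoly (Fin m) ℤ) := by
  have hne : {n : ℕ | HasBinaryDetRepr (perPoly (Fin m) ℤ) n}.Nonempty :=
    ⟨_, huttenhainIkenmeyer2016_thm2 m⟩
  have hb : HasBinaryDetRepr (perPoly (Fin m) ℤ) (binaryDetComplexity (perPoly (Fin m) ℤ)) := by
    unfold binaryDetComplexity
    exact Nat.sInf_mem hne
  have h := hb.hasDetRepr_map ℂ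
  rw [map_perPoly] at h
  exact determinantalComplexity_le_of_hasDetRepr h

/-- **V0 implies the binary statement, not conversely.** `DetqpThesis` (V0) implies that
`bdc(per_m)` is not quasi-polynomially bounded (`dc_ℂ ≤ bdc`); a lower bound on `bdc` — e.g. HI16
Prop. 12's reading `per ∉ DET⁰ = VP_s⁰` — does not feed V0 without constant elimination.
Hüttenhain–Ikenmeyer 2016, §1, Prop. 12. [cite: HuttenhainIkenmeyer2016, §1] -/
theorem not_isQPBounded_bdc_of_detqpThesis (h : Theses.DetQP.DetqpThesis) :
    ¬ IsQPBounded fun m => binaryDetComplexity (perPoly (Fin m) ℤ) := by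
  unfold Theses.DetQP.DetqpThesis at h
  exact not_isQPBounded_of_eventually_le h
    ⟨0, fun m _ => determinantalComplexity_complex_le_binaryDetComplexity m⟩

end

end Summit.ValiantsHypothesis.ValiantsHypothesis.Theorems.LMRWhatWouldSufficeTyped
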